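import Summits.QuantumFields.BalabanUV.Beta.EriceFlowEnclosureB12AsPrintedHistoryJumpRuns
import Summits.QuantumFields.BalabanUV.Beta.EriceFlowEnclosureB12AsPrintedLastVar

/-!
# Beta / EriceFlowEnclosureB12AsPrintedHistoryJumpEnd — the continuity letter of Theorem 2 on the as-printed interface of [I], part 3:
# ONE explicit jump (J(x) := x²·𝟙_D(x), D = {1∕(n+2) : n ∈ ℕ}), the integer-gap argument, the toy setting satisfying
# `StandingHypotheses ∧ Definitions ∧ Conclusions` WITH the p. 266 flag, and the headlines: **JOINT CONTINUITY IN THE PRECEDING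
# COUPLINGS IS LOAD-BEARING in every Theorem-2 reduction of the cell** (β-flow team, prover 1, unit `b2b-balaban-beta-bflow-p1`, gen 33;
# ROW AP-I; PART 1 = `…B12AsPrintedHistoryJump`, PART 2 = `…B12AsPrintedHistoryJumpRuns`; contrast module `…B12AsPrintedHistoryJumpMarkov`)

HONEST FRAMING (page 1 of everything the β sub-cell writes): discharging `BetaPertH` makes Bałaban's UV stability UNCONDITIONAL — a
real constructive-QFT result; it is NOT the continuum limit and NOT the Clay problem.  HONEST DEPENDENCY (cell reorg 2026-08-19,
verbatim): «continuum YM on T⁴ ⇐ BetaPertH ∧ nine spine estimates (0/9 proved); BetaPertH ⇐ (D1) ∧ (D4) ∧ CAP+tail; G-an2-4 gates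
asym, D1 and NE2/3/4.»  THIS MODULE DISCHARGES NOTHING: it builds ONE toy setting of `B12BetaAsPrinted` ([Balaban1987RG1] as typed,
p537882 ✓ ∕ v1.1 p539116 ✓) inside an existence proof (def-free) — β₁ := 1∕100, β₂(g₀, g₁) := 1∕100 + J(g₀)·g₁, β_{k+1} := 1∕100
(k ≥ 2), J(x) = x²·𝟙_D(x), Π_{k+1} := β_{k+1}·Re Qᵀ, runs = forward solutions of (0.20), the p. 266 cut-off flag ON — and reads off what
the cell's Theorem-2 reductions cannot do without.  The toy is OURS; nothing of Bałaban's objects is asserted; (C) remains the cell's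
located HYPOTHESIS for the construction (not printed for the preceding couplings: p. 298; printed for all couplings qualitatively only
in p. 266's sentence on the alternative cut-off, typed `B12CouplingClausesHistory.BetaAnalyticInCouplings266`).

THE GAP (why Theorem 2 fails for the toy).  By PART 2's `readout_two`, g₂ = g is reached from g₀ iff 1∕g₀² − J(g₀)·g₁ = 1∕g² + 2b,
g₁ = (1∕g₀² − b)^{−1∕2}.  Take 1∕g² + 2b = (n + 2)².  If g₀ ∉ D the equation reads 1∕g₀² = (n + 2)², i.e. g₀ = 1∕(n + 2) ∈ D —
absurd; if g₀ = 1∕(m + 2) ∈ D it reads (m + 2)² − (n + 2)² = g₁∕(m + 2)² ∈ ]0, 1[ — an integer strictly between 0 and 1, absurd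
(`readout_gap`).  So for every g₁ > 0 the renormalized coupling g = ((n + 2)² − 2b)^{−1∕2} ≤ g₁ (n large) has NO bare coupling g₀(ε, g)
at ε = L^{−2}: [I] Theorem 2's «there exists a bare coupling constant g₀ = g₀(ε, g) such that … g_K = g» fails at K = 2.

WHAT THIS FILE PROVES (0 sorry, 0 def):
§5 the jump J = x²·𝟙_D: `jump_nonneg`, `jump_le_sq`, `jump_le_quarter`, `jump_of_mem`, `jump_between` (J = 0 strictly between consecutive
   points of D), **`readout_gap`**, `readout_gap_unbounded` (PART 2's `hgap`), `not_betaContH_of_histJumpD` ((C) fails on every box).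
§6 **`histJumpToy_exists`** (∃ S: the defining hypotheses, γ = 1, flag ON, `StandingHypotheses ∧ Definitions ∧ Conclusions`).
§7 HEADLINES: **`asPrinted_allLetters_not_theorem2`** (∃ S hH: Definitions ∧ Conclusions ∧ B12BetaAsPrinted ∧ altCutoff266 ∧ BetaPertH S.β (1∕100)
   ∧ BetaLowerH ∧ BetaUpperH ∧ BetaSmoothInLast264 ∧ BetaAnalyticInLast264 ∧ BetaDerivsUniformInLast264 ∧ LastVarLipschitz ∧ LastVarLipschitzAtZero
   ∧ (AF-0@face) ∧ runs at every depth ∧ (∀ γ > 0, ¬BetaContH γ S.β) ∧ ¬Theorem2Statement); **`histCont_loadBearing`** (dropping (C) from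
   `…B12AsPrintedUpper.theorem2Statement_of_pertH`, from `…theorem2Statement_of_letters`, and from an4's `theorem2Statement_of_uniform264`
   yields FALSE statements — even with `Conclusions S` added as a hypothesis); `not_betaContH_via_reduction` (for the toy, ¬(C) also FOLLOWS
   from prover 1's reduction + ¬Theorem 2); the contrast **`theorem2Statement_of_pertH_of_couplings266`** (p. 266's plural reading
   `BetaAnalyticInCouplings266` + `BetaPertH` (β̄ > 0) + `Definitions` ⟹ Theorem 2 AS PRINTED) and `not_analyticInCouplings266_of_toy`.
READING (ours, said once): on the as-printed carrier the located unprinted input of Theorem 2's FIRST SENTENCE is not only the sign∕size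
of β (AF) but also the CONTINUITY OF β_{k+1} IN g₀, …, g_{k−1}; [I] prints it nowhere for the standard cut-off (2.9) (p. 264: last
variable; p. 298: dependence exists), and for the alternative cut-off only as p. 266's plural, whose typed home is
`BetaAnalyticInCouplings266`, not `Conclusions.c264`.
NOT CLAIMED: anything about Bałaban's β; that (C) fails for the construction; `BetaPertH` for the construction; continuum; Clay.
-/

namespace Summit.QuantumFields.BalabanUV.Beta.EriceFlowEnclosureB12AsPrintedHistoryJumpEnd

open Filter Topology
open Literature.MathematicalPhysics.QuantumFieldTheory.GawedzkiKupiainen1985.PeriodicGleason (Pt ExpBound)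
open Literature.MathematicalPhysics.QuantumFieldTheory.Balaban1983to89
open Literature.MathematicalPhysics.QuantumFieldTheory.Balaban1983to89.B12Rep537 (wilsonQ MQ)
open Literature.MathematicalPhysics.QuantumFieldTheory.Balaban1983to89.B12BetaAsPrinted
open Literature.MathematicalPhysics.QuantumFieldTheory.Balaban1983to89.FlowStep (prefixOf Box mem_box BetaContH BetaLowerH
  BetaUpperH BetaPertH)
open Literature.MathematicalPhysics.QuantumFieldTheory.Balaban1983to89.BetaDerivClause (LastVarLipschitz LastVarLipschitzAtZero)
open Literature.MathematicalPhysics.QuantumFieldTheory.Balaban1983to89.B12CouplingClausesHistory (BetaSmoothInLast264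
  BetaAnalyticInLast264 BetaDerivsUniformInLast264 BetaAnalyticInCouplings266 betaContH_of_analyticInCouplings266)
open Summit.QuantumFields.BalabanUV.Beta.EriceFlowEnclosureB12AsPrintedMarginal (wilsonQ_perm wilsonQ_neg_transpose)
open Summit.QuantumFields.BalabanUV.Beta.EriceFlowEnclosureB12AsPrintedUpper (theorem2Statement_of_letters theorem2Statement_of_pertH)
open Summit.QuantumFields.BalabanUV.Beta.EriceFlowEnclosureB12AsPrintedWitness (secondMoment_toyKernel fourier_toyKernel
  decay510_toyKernel reflect_toyKernel rep537_toyKernel)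
open Summit.QuantumFields.BalabanUV.Beta.EriceFlowEnclosureB12AsPrintedLastVar (rep537_diag expBound_zero)
open Summit.QuantumFields.BalabanUV.Beta.EriceFlowEnclosureB12AsPrintedHistoryJump
open Summit.QuantumFields.BalabanUV.Beta.EriceFlowEnclosureB12AsPrintedHistoryJumpRuns

noncomputable section

/-! ## §5 One explicit jump: J(x) = x²·𝟙_D(x), D = {1∕(n + 2) : n ∈ ℕ} -/

/-- J ≥ 0. [folklore] -/
theorem jump_nonneg (x : ℝ) : 0 ≤ Set.indicator (Set.range fun n : ℕ => 1 / ((n : ℝ) + 2)) (fun x : ℝ => x ^ 2) x :=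
  Set.indicator_nonneg (fun y _ => sq_nonneg y) x

/-- J(x) ≤ x². [folklore] -/
theorem jump_le_sq (x : ℝ) : Set.indicator (Set.range fun n : ℕ => 1 / ((n : ℝ) + 2)) (fun x : ℝ => x ^ 2) x ≤ x ^ 2 :=
  Set.indicator_apply_le' (fun _ => le_rfl) (fun _ => sq_nonneg x)

/-- J ≤ 1∕4 everywhere (the points of D are ≤ 1∕2). [folklore] -/
theorem jump_le_quarter (x : ℝ) : Set.indicator (Set.range fun n : ℕ => 1 / ((n : ℝ) + 2)) (fun x : ℝ => x ^ 2) x ≤ 1 / 4 := by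
  refine Set.indicator_apply_le' (fun hx => ?_) (fun _ => by norm_num)
  obtain ⟨n, rfl⟩ := hx
  have hn : (0 : ℝ) ≤ n := Nat.cast_nonneg n
  have h2 : (2 : ℝ) ≤ (n : ℝ) + 2 := by linarith
  have hle : 1 / ((n : ℝ) + 2) ≤ 1 / 2 := one_div_le_one_div_of_le (by norm_num) h2
  have hge : 0 ≤ 1 / ((n : ℝ) + 2) := by positivity
  show (1 / ((n : ℝ) + 2)) ^ 2 ≤ 1 / 4
  nlinarith

/-- J(1∕(n + 2)) = 1∕(n + 2)². [folklore] -/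
theorem jump_of_mem (n : ℕ) :
    Set.indicator (Set.range fun n : ℕ => 1 / ((n : ℝ) + 2)) (fun x : ℝ => x ^ 2) (1 / ((n : ℝ) + 2)) = (1 / ((n : ℝ) + 2)) ^ 2 :=
  Set.indicator_of_mem (Set.mem_range_self n) _

/-- J vanishes strictly between two consecutive points 1∕(n + 2) < x < 1∕(n + 1) of D. [folklore] -/
theorem jump_between (n : ℕ) {x : ℝ} (h1 : 1 / ((n : ℝ) + 2) < x) (h2 : x < 1 / ((n : ℝ) + 1)) :
    Set.indicator (Set.range fun n : ℕ => 1 / ((n : ℝ) + 2)) (fun x : ℝ => x ^ 2) x = 0 := by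
  refine Set.indicator_of_notMem (fun hx => ?_) _
  obtain ⟨m, rfl⟩ := hx
  have hm : (0 : ℝ) < (m : ℝ) + 2 := by positivity
  have hn1 : (0 : ℝ) < (n : ℝ) + 1 := by positivity
  have hn2 : (0 : ℝ) < (n : ℝ) + 2 := by positivity
  have a : (m : ℝ) + 2 < (n : ℝ) + 2 := by
    have := (one_div_lt_one_div hn2 hm).1 h1; linarith
  have b' : (n : ℝ) + 1 < (m : ℝ) + 2 := (one_div_lt_one_div hm hn1).1 h2
  have a' : m < n := by exact_mod_cast (show (m : ℝ) < n by linarith)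
  have b'' : n < m + 1 := by exact_mod_cast (show (n : ℝ) < m + 1 by linarith)
  omega

/-- **THE INTEGER GAP.**  For 0 < b ≤ 1 and every n: no x > 0 with b < 1∕x² solves 1∕x² − J(x)·(1∕x² − b)^{−1∕2} = (n + 2)².  (Off D the
equation says x = 1∕(n + 2) ∈ D; at x = 1∕(m + 2) ∈ D it says (m + 2)² − (n + 2)² = g₁∕(m + 2)² with 0 < g₁ < 1 — an integer in ]0, 1[.)
[folklore] -/
theorem readout_gap {b : ℝ} (hb : 0 < b) (hb1 : b ≤ 1) (n : ℕ) {x : ℝ} (hx : 0 < x) (hbx : b < 1 / x ^ 2) :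
    1 / x ^ 2 - Set.indicator (Set.range fun n : ℕ => 1 / ((n : ℝ) + 2)) (fun x : ℝ => x ^ 2) x * (1 / Real.sqrt (1 / x ^ 2 - b)) ≠
      ((n : ℝ) + 2) ^ 2 := by
  intro h
  by_cases hmem : x ∈ Set.range fun n : ℕ => 1 / ((n : ℝ) + 2)
  · obtain ⟨m, rfl⟩ := hmem
    rw [jump_of_mem m] at h
    have hm : (0 : ℝ) < (m : ℝ) + 2 := by positivity
    have hsq : 1 / (1 / ((m : ℝ) + 2)) ^ 2 = ((m : ℝ) + 2) ^ 2 := by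
      rw [div_pow, one_pow, one_div_one_div]
    rw [hsq] at h hbx
    -- the correction term c = (1∕(m+2))²·g₁ lies in ]0, 1[
    have hrad : 0 < ((m : ℝ) + 2) ^ 2 - b := by linarith
    have hg1pos : 0 < 1 / Real.sqrt (((m : ℝ) + 2) ^ 2 - b) := by positivity
    have hg1lt : 1 / Real.sqrt (((m : ℝ) + 2) ^ 2 - b) < 1 := by
      rw [div_lt_one (Real.sqrt_pos.mpr hrad)]
      have h4 : (1 : ℝ) < ((m : ℝ) + 2) ^ 2 - b := by nlinarith [Nat.cast_nonneg (α := ℝ) m]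
      calc (1 : ℝ) = Real.sqrt 1 := Real.sqrt_one.symm
        _ < Real.sqrt (((m : ℝ) + 2) ^ 2 - b) := Real.sqrt_lt_sqrt zero_le_one h4
    have hxsq : (1 / ((m : ℝ) + 2)) ^ 2 ≤ 1 := by
      rw [div_pow, one_pow, div_le_one (by positivity)]; nlinarith [Nat.cast_nonneg (α := ℝ) m]
    have hcpos : 0 < (1 / ((m : ℝ) + 2)) ^ 2 * (1 / Real.sqrt (((m : ℝ) + 2) ^ 2 - b)) := by positivity
    have hclt : (1 / ((m : ℝ) + 2)) ^ 2 * (1 / Real.sqrt (((m : ℝ) + 2) ^ 2 - b)) < 1 := by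
      calc (1 / ((m : ℝ) + 2)) ^ 2 * (1 / Real.sqrt (((m : ℝ) + 2) ^ 2 - b))
          ≤ 1 * (1 / Real.sqrt (((m : ℝ) + 2) ^ 2 - b)) := by gcongr
        _ < 1 := by rw [one_mul]; exact hg1lt
    -- an integer strictly between 0 and 1
    have hint : (((((m : ℤ) + 2) ^ 2 - ((n : ℤ) + 2) ^ 2 : ℤ)) : ℝ) =
        (1 / ((m : ℝ) + 2)) ^ 2 * (1 / Real.sqrt (((m : ℝ) + 2) ^ 2 - b)) := by
      push_cast; linarith
    have h0 : (0 : ℤ) < ((m : ℤ) + 2) ^ 2 - ((n : ℤ) + 2) ^ 2 := by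
      have : (0 : ℝ) < (((((m : ℤ) + 2) ^ 2 - ((n : ℤ) + 2) ^ 2 : ℤ)) : ℝ) := by rw [hint]; exact hcpos
      exact_mod_cast this
    have h1 : ((m : ℤ) + 2) ^ 2 - ((n : ℤ) + 2) ^ 2 < (1 : ℤ) := by
      have : (((((m : ℤ) + 2) ^ 2 - ((n : ℤ) + 2) ^ 2 : ℤ)) : ℝ) < 1 := by rw [hint]; exact hclt
      exact_mod_cast this
    omega
  · rw [Set.indicator_of_notMem hmem, zero_mul, sub_zero] at h
    apply hmem
    refine ⟨n, ?_⟩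
    have hn : (0 : ℝ) < (n : ℝ) + 2 := by positivity
    have hx2 : x ^ 2 = (1 / ((n : ℝ) + 2)) ^ 2 := by
      rw [div_pow, one_pow, ← one_div_one_div (x ^ 2), h]
    have := (sq_eq_sq₀ hx.le (by positivity)).1 hx2
    exact this.symm

/-- **PART 2's `hgap`**: the depth-2 read-out misses the arbitrarily large values (n + 2)². [folklore] -/
theorem readout_gap_unbounded {b : ℝ} (hb : 0 < b) (hb1 : b ≤ 1) (z₀ : ℝ) :
    ∃ z : ℝ, z₀ ≤ z ∧ ∀ x : ℝ, 0 < x → b < 1 / x ^ 2 →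
      1 / x ^ 2 - Set.indicator (Set.range fun n : ℕ => 1 / ((n : ℝ) + 2)) (fun x : ℝ => x ^ 2) x * (1 / Real.sqrt (1 / x ^ 2 - b)) ≠ z := by
  refine ⟨((⌈z₀⌉₊ : ℝ) + 2) ^ 2, ?_, fun x hx hbx => readout_gap hb hb1 ⌈z₀⌉₊ hx hbx⟩
  have h1 : z₀ ≤ (⌈z₀⌉₊ : ℝ) := Nat.le_ceil z₀
  nlinarith [Nat.cast_nonneg (α := ℝ) ⌈z₀⌉₊]

variable {S : Setting}

/-- **(C) FAILS ON EVERY BOX for the history-jump family with J = x²·𝟙_D**: at x₀ = 1∕(n + 2) ≤ γ, J(x₀) ≠ 0 while J = 0 along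
x₀ + η∕(j + 2) → x₀ (η = 1∕(n + 1) − 1∕(n + 2)); PART 1's `not_betaContH_of_jump`. [cite: Balaban1987RG1, p.298 («depends also on all preceding coupling constants»)] -/
theorem not_betaContH_of_histJumpD
    (hβ : ∀ (k : ℕ) (p : Fin (k + 1) → ℝ), S.β k p = 1 / 100 +
      (if k = 1 then Set.indicator (Set.range fun n : ℕ => 1 / ((n : ℝ) + 2)) (fun x : ℝ => x ^ 2) (p 0) else 0) * p (Fin.last k))
    {γ : ℝ} (hγ : 0 < γ) : ¬ BetaContH γ S.β := by
  obtain ⟨n, hn⟩ := exists_nat_one_div_lt hγ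
  have hn1 : (0 : ℝ) < (n : ℝ) + 1 := by positivity
  have hn2 : (0 : ℝ) < (n : ℝ) + 2 := by positivity
  have hlt : 1 / ((n : ℝ) + 2) < 1 / ((n : ℝ) + 1) := one_div_lt_one_div_of_lt hn1 (by linarith)
  set η : ℝ := 1 / ((n : ℝ) + 1) - 1 / ((n : ℝ) + 2) with hη
  have hηpos : 0 < η := by rw [hη]; linarith
  refine not_betaContH_of_jump hβ (x₀ := 1 / ((n : ℝ) + 2)) (u := fun j : ℕ => 1 / ((n : ℝ) + 2) + η / ((j + 2 : ℕ) : ℝ))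
    (by positivity) (le_of_lt (hlt.trans hn)) ?_ (fun j => ?_) ?_
  · rw [jump_of_mem]; positivity
  · have hj : (1 : ℝ) < ((j + 2 : ℕ) : ℝ) := by push_cast; linarith [Nat.cast_nonneg (α := ℝ) j]
    have hj0 : (0 : ℝ) < ((j + 2 : ℕ) : ℝ) := by linarith
    have hsmall : η / ((j + 2 : ℕ) : ℝ) < η := div_lt_self hηpos hj
    have hpos' : 0 < η / ((j + 2 : ℕ) : ℝ) := div_pos hηpos hj0
    have hup : 1 / ((n : ℝ) + 2) + η / ((j + 2 : ℕ) : ℝ) < 1 / ((n : ℝ) + 1) := by rw [hη] at hsmall ⊢; linarith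
    refine ⟨by positivity, le_of_lt (hup.trans hn), jump_between n (by linarith) hup⟩
  · have h := (tendsto_const_div_atTop_nhds_zero_nat η).comp (tendsto_add_atTop_nat 2)
    have h' : Tendsto (fun j : ℕ => 1 / ((n : ℝ) + 2) + η / ((j + 2 : ℕ) : ℝ)) atTop (𝓝 (1 / ((n : ℝ) + 2) + 0)) :=
      tendsto_const_nhds.add h
    rwa [add_zero] at h'

/-- The last entry of a run's section history is the section variable. [folklore] -/
theorem sectionHist_last (S₀ : Setting) (P : B12.RunParams) (j : ℕ) (s : ℝ) : sectionHist S₀ P j s (Fin.last j) = s := by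
  simp [sectionHist]

/-- Size bookkeeping for the toy's term slots: with slope a ∈ [0, 1∕4] and last coupling t ∈ [0, 1]. [folklore] -/
theorem abs_affine_bounds {a t : ℝ} (ha : 0 ≤ a ∧ a ≤ 1 / 4) (ht : t ∈ Set.Icc (0 : ℝ) 1) :
    |1 / 100 + a * t| ≤ 1 ∧ |a * t| ≤ 1 ∧ |1 / 100 + a * t| ≤ 2 * 1 := by
  have h0 : 0 ≤ a * t := mul_nonneg ha.1 ht.1
  have h1 : a * t ≤ 1 / 4 := by nlinarith [ht.2, ha.2]
  refine ⟨?_, ?_, ?_⟩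
  · rw [abs_of_nonneg (by linarith)]; linarith
  · rw [abs_of_nonneg h0]; linarith
  · rw [abs_of_nonneg (by linarith)]; linarith

/-! ## §6 The toy setting -/

/-- **THE HISTORY-JUMP TOY**: L = 13, γ = 1, β₁ := 1∕100, β₂(g₀, g₁) := 1∕100 + J(g₀)·g₁ (J = x²·𝟙_D), β_{k+1} := 1∕100 (k ≥ 2) — one-loop
part 1∕100 from log Z, interaction part J(g₀)·g_k from 𝐄_int (vanishing at g_k = 0, history-free there, as (2.13)–(2.14) demand) —,
Π_{k+1} := β_{k+1}·Re Qᵀ, pol F := F(1)·Re Qᵀ, (1.18)-slot «|F(1)| ≤ E», E₀ = δ₁ = 1, C510 = MQ(1, 4), C544 = 2, THE p. 266 CUT-OFF FLAG ON,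
runs = forward solutions of (0.20).  It satisfies `StandingHypotheses ∧ Definitions ∧ Conclusions`. [folklore] -/
theorem histJumpToy_exists : ∃ S : Setting,
    (∀ (k : ℕ) (p : Fin (k + 1) → ℝ), S.β k p = 1 / 100 +
      (if k = 1 then Set.indicator (Set.range fun n : ℕ => 1 / ((n : ℝ) + 2)) (fun x : ℝ => x ^ 2) (p 0) else 0) * p (Fin.last k)) ∧
    (∀ (P : B12.RunParams) (k : ℕ), S.cpl P k = Nat.rec (motive := fun _ => ℝ) P.g0
      (fun k g => 1 / Real.sqrt (1 / g ^ 2 - (1 / 100 +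
        (if k = 1 then Set.indicator (Set.range fun n : ℕ => 1 / ((n : ℝ) + 2)) (fun x : ℝ => x ^ 2) P.g0 else 0) * g))) k) ∧
    S.γ = 1 ∧ S.altCutoff266 ∧ StandingHypotheses S ∧ Definitions S ∧ Conclusions S := by
  -- `Setting` fields in order: L, groupScope, ε₀, cpl, β, γ, M, κ, Cfg, one, logZ, Eint, Ebold, repr437, α₀, α₁, E₀, Mκ, pol, polIV, κ₀,
  -- indAss, ε₁, altCutoff266, logN2, δ₀, δ₁, C510, C544 (anonymous constructor).
  refine ⟨⟨13, True, 1,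
      fun P k => Nat.rec (motive := fun _ => ℝ) P.g0
        (fun k g => 1 / Real.sqrt (1 / g ^ 2 - (1 / 100 +
          (if k = 1 then Set.indicator (Set.range fun n : ℕ => 1 / ((n : ℝ) + 2)) (fun x : ℝ => x ^ 2) P.g0 else 0) * g))) k,
      fun k p => 1 / 100 +
        (if k = 1 then Set.indicator (Set.range fun n : ℕ => 1 / ((n : ℝ) + 2)) (fun x : ℝ => x ^ 2) (p 0) else 0) * p (Fin.last k),
      1, 1, 1, fun _ => Unit, fun _ => (), fun _ _ => 1 / 100,
      fun k p _ => (if k = 1 then Set.indicator (Set.range fun n : ℕ => 1 / ((n : ℝ) + 2)) (fun x : ℝ => x ^ 2) (p 0) else 0) *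
        p (Fin.last k),
      fun k p _ => 1 / 100 +
        (if k = 1 then Set.indicator (Set.range fun n : ℕ => 1 / ((n : ℝ) + 2)) (fun x : ℝ => x ^ 2) (p 0) else 0) * p (Fin.last k),
      fun _ F E => |F ()| ≤ E, 1, 1, 1, fun _ => 1, fun _ F => fun μ ν x => F () * (wilsonQ ν μ x).re,
      fun k p => fun μ ν x => (1 / 100 +
        (if k = 1 then Set.indicator (Set.range fun n : ℕ => 1 / ((n : ℝ) + 2)) (fun x : ℝ => x ^ 2) (p 0) else 0) * p (Fin.last k)) *
          (wilsonQ ν μ x).re,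
      1, fun _ _ => True, 1, True,
      fun k p => (if k = 1 then Set.indicator (Set.range fun n : ℕ => 1 / ((n : ℝ) + 2)) (fun x : ℝ => x ^ 2) (p 0) else 0) *
        p (Fin.last k),
      1, 1, MQ 1 4, 2⟩,
    fun _ _ => rfl, fun _ _ => rfl, rfl, trivial, ?_, ?_, ?_⟩
  · exact { hL := ⟨by decide, by norm_num⟩, hG := trivial, hκ₀ := by norm_num, hMκ := by norm_num, hγ := by norm_num,
            hε₀ := by norm_num, hε₁ := by norm_num, hα₀ := by norm_num, hα₁ := by norm_num, hκ := by norm_num,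
            hM := by norm_num }
  · refine { d018 := fun P => rfl, d020 := ?_, d13 := ?_, d213 := ?_, d214 := ?_, d120 := ?_, d120split := ?_,
             d121 := ?_, d122 := ?_ }
    · exact definitions_d020_of_histJump (b := 1 / 100) (fun _ _ => rfl) (fun _ _ => rfl)
    · intro j p U; simp
    · intro k p p' hp hp'
      show (fun _ : Unit => (if k = 1 then Set.indicator (Set.range fun n : ℕ => 1 / ((n : ℝ) + 2)) (fun x : ℝ => x ^ 2) (p 0)
          else 0) * p (Fin.last k)) =
        fun _ : Unit => (if k = 1 then Set.indicator (Set.range fun n : ℕ => 1 / ((n : ℝ) + 2)) (fun x : ℝ => x ^ 2) (p' 0)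
          else 0) * p' (Fin.last k)
      rw [hp, hp', mul_zero, mul_zero]
    · intro k p; rfl
    · intro j p; rfl
    · intro j p; funext μ ν x; simp only [Pi.add_apply]; ring
    · intro k p
      refine ⟨fun σ μ ν x => congrArg (fun r : ℝ => (1 / 100 + (if k = 1 then
            Set.indicator (Set.range fun n : ℕ => 1 / ((n : ℝ) + 2)) (fun x : ℝ => x ^ 2) (p 0) else 0) * p (Fin.last k)) * r)
          (congrArg Complex.re (wilsonQ_perm σ ν μ x)),
        fun ε hε μ ν z => reflect_toyKernel _ hε μ ν z,
        fun μ ν z => congrArg (fun r : ℝ => (1 / 100 + (if k = 1 then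
            Set.indicator (Set.range fun n : ℕ => 1 / ((n : ℝ) + 2)) (fun x : ℝ => x ^ 2) (p 0) else 0) * p (Fin.last k)) * r)
          (congrArg Complex.re (wilsonQ_neg_transpose ν μ z).symm)⟩
    · intro j p _ μ ν hμν
      exact ⟨(fourier_toyKernel hμν _).symm, (secondMoment_toyKernel hμν _).symm⟩
  · -- size bookkeeping: 0 ≤ slope ≤ 1∕4 (J ≤ 1∕4 everywhere)
    have hsl : ∀ (k : ℕ) (x : ℝ), 0 ≤ (if k = 1 then Set.indicator (Set.range fun n : ℕ => 1 / ((n : ℝ) + 2)) (fun x : ℝ => x ^ 2) x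
        else 0) ∧ (if k = 1 then Set.indicator (Set.range fun n : ℕ => 1 / ((n : ℝ) + 2)) (fun x : ℝ => x ^ 2) x else 0) ≤ 1 / 4 := by
      intro k x
      by_cases hk : k = 1
      · simp only [hk, if_true]; exact ⟨jump_nonneg x, jump_le_quarter x⟩
      · simp only [hk, if_false]; norm_num
    refine { c13 := fun _ _ _ _ => trivial, c118 := fun P _ j _ s hs => ⟨?_, ?_⟩, c264 := ?_, c510 := ?_, c537 := ?_ }
    · exact (abs_affine_bounds (hsl j _) (by rw [sectionHist_last]; exact hs)).1
    · exact (abs_affine_bounds (hsl j _) (by rw [sectionHist_last]; exact hs)).2.1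
    · exact c264_of_histJump (b := 1 / 100) (fun _ _ => rfl) (by norm_num) jump_nonneg jump_le_sq (by norm_num)
    · refine ⟨by norm_num, fun j F E hF μ ν x => ?_⟩
      have hF' : |F ()| ≤ E := hF
      have hd := decay510_toyKernel (d := 4) (F ()) μ ν x
      have hMQ := B12Rep537.MQ_nonneg 1 4
      show |F () * (wilsonQ ν μ x).re| ≤ MQ 1 4 * E * Real.exp (-1 * B12Sec2to5.l1 x)
      calc |F () * (wilsonQ ν μ x).re| ≤ |F ()| * MQ 1 4 * Real.exp (-1 * B12Sec2to5.l1 x) := hd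
        _ ≤ E * MQ 1 4 * Real.exp (-1 * B12Sec2to5.l1 x) := by gcongr
        _ = MQ 1 4 * E * Real.exp (-1 * B12Sec2to5.l1 x) := by ring
    · intro P _ j _ s hs μ ν
      by_cases hμν : μ = ν
      · subst hμν
        exact ⟨fun _ _ => 0, fun x => rep537_diag _ μ x, fun w => expBound_zero _ _ (by norm_num)⟩
      · obtain ⟨rem, hrep, hdec⟩ := rep537_toyKernel (d := 4) hμν
          (1 / 100 + (if j = 1 then Set.indicator (Set.range fun n : ℕ => 1 / ((n : ℝ) + 2)) (fun x : ℝ => x ^ 2)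
            (sectionHist _ P j s 0) else 0) * sectionHist _ P j s (Fin.last j)) (1 / 2)
        exact ⟨rem, hrep, fun w => (hdec w).mono (abs_affine_bounds (hsl j _) (by rw [sectionHist_last]; exact hs)).2.2⟩

/-! ## §7 Headlines: (C) is load-bearing -/

/-- **[I] AS PRINTED + EVERY OTHER LETTER OF THE CELL'S THEOREM-2 REDUCTIONS, WITHOUT (C), DOES NOT GIVE THEOREM 2.**  There is a setting
with `StandingHypotheses ∧ Definitions ∧ Conclusions` (hence `B12BetaAsPrinted S`), the p. 266 flag ON (so `c264`'s analytic member is in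
force), `BetaPertH S.β (1∕100)`, the AF letters `BetaLowerH (1∕100)` ∕ `BetaUpperH (1∕100 + γ³)`, every last-variable schema
(`BetaSmoothInLast264`, `BetaAnalyticInLast264`, `BetaDerivsUniformInLast264` with table (1∕100 + γ³, γ², 0, …)), row I1's k-uniform
`LastVarLipschitz S.β γ² γ` and `LastVarLipschitzAtZero`, (AF-0@face) with one-loop number 1∕100, runs Theorem 3 speaks of at EVERY depth
— and yet `BetaContH γ S.β` fails for every γ > 0 and `Theorem2Statement S hL` is FALSE. [cite: Balaban1987RG1, Thm 2 p.259 with p.264 (β-clause after (1.22)) and p.298] -/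
theorem asPrinted_allLetters_not_theorem2 :
    ∃ S : Setting, ∃ hH : StandingHypotheses S, Definitions S ∧ Conclusions S ∧ B12BetaAsPrinted S ∧ S.altCutoff266 ∧
      BetaPertH S.β (1 / 100) ∧ BetaLowerH (1 / 100) S.γ S.β ∧ BetaUpperH (1 / 100 + S.γ ^ 3) S.γ S.β ∧
      BetaSmoothInLast264 S.γ S.β ∧ BetaAnalyticInLast264 S.γ S.β ∧
      BetaDerivsUniformInLast264 S.γ S.β (fun n => if n = 0 then 1 / 100 + S.γ ^ 3 else if n = 1 then S.γ ^ 2 else 0) ∧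
      LastVarLipschitz S.β (S.γ ^ 2) S.γ ∧ LastVarLipschitzAtZero S.β (S.γ ^ 2) S.γ ∧
      (∀ (k : ℕ) (p : Fin (k + 1) → ℝ), p ∈ B12Beta.HistBox S.γ k → 2 * (1 / 200) ≤ S.β k (Function.update p (Fin.last k) 0)) ∧
      (∀ K m : ℕ, ∃ g₀ : ℝ, 0 < g₀ ∧ RunHyp S ⟨K, m, g₀⟩) ∧
      (∀ γ : ℝ, 0 < γ → ¬ BetaContH γ S.β) ∧ ¬ Theorem2Statement S (hL_of_standing hH) := by
  obtain ⟨S, hβ, hcpl, hγ, halt, hH, hD, hC⟩ := histJumpToy_exists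
  have hγpos : 0 < S.γ := by rw [hγ]; norm_num
  have hface := af0_face_of_histJump hβ S.γ
  refine ⟨S, hH, hD, hC, fun _ _ => hC, halt, betaPertH_of_histJump hβ jump_nonneg jump_le_sq,
    betaLowerH_of_histJump hβ jump_nonneg jump_le_sq S.γ, betaUpperH_of_histJump hβ jump_nonneg jump_le_sq hγpos,
    betaSmoothInLast264_of_histJump hβ S.γ, betaAnalyticInLast264_of_histJump hβ S.γ,
    betaDerivsUniformInLast264_of_histJump hβ (by norm_num) jump_nonneg jump_le_sq hγpos,
    lastVarLipschitz_of_histJump hβ jump_nonneg jump_le_sq S.γ, lastVarLipschitzAtZero_of_histJump hβ jump_nonneg jump_le_sq S.γ,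
    fun k p hp => by have := hface k p hp; linarith,
    fun K m => runs_every_depth hβ hcpl (by norm_num) jump_nonneg jump_le_sq hγpos (by rw [hγ]) K m,
    fun γ hγ' => not_betaContH_of_histJumpD hβ hγ',
    not_theorem2Statement_of_gap hcpl (readout_gap_unbounded (by norm_num) (by norm_num))⟩

/-- **(C) IS LOAD-BEARING.**  Each of the following — a Theorem-2 reduction of the cell with its joint-continuity binder DROPPED, and
`Conclusions S` ADDED — is FALSE: (i) prover 1's `…B12AsPrintedUpper.theorem2Statement_of_pertH` without `hcont` (so `BetaPertH` + print ⇏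
Theorem 2); (ii) prover 1's `theorem2Statement_of_letters` without `hcont` (0 < b ≤ β_{k+1} ≤ b′ box-wide + print ⇏ Theorem 2); (iii) an4's
`B12AsPrintedRowD4JunctionThm2.theorem2Statement_of_uniform264` without `hcont` (p. 264 smooth + the j- and history-UNIFORM all-orders reading +
(AF-0@face) + b(1)·γ ≤ b_AF + print ⇏ Theorem 2).  Witness: the history-jump toy (§6) at γ = 1, resp. γ = 1∕10 in (iii). [cite: Balaban1987RG1, Thm 2 p.259 with p.264 (β-clause after (1.22)) and p.298] -/
theorem histCont_loadBearing :
    (¬ ∀ (S : Setting) (hH : StandingHypotheses S), Definitions S → Conclusions S → ∀ βbar : ℝ, 0 < βbar →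
        BetaPertH S.β βbar → Theorem2Statement S (hL_of_standing hH)) ∧
    (¬ ∀ (S : Setting) (hH : StandingHypotheses S), Definitions S → Conclusions S → ∀ γ₀ b b' : ℝ, 0 < γ₀ → 0 < b → b ≤ b' →
        BetaLowerH b γ₀ S.β → BetaUpperH b' γ₀ S.β → Theorem2Statement S (hL_of_standing hH)) ∧
    (¬ ∀ (S : Setting) (hH : StandingHypotheses S), Definitions S → Conclusions S → ∀ (γ b : ℝ) (bt : ℕ → ℝ), 0 < γ → 0 < b →
        BetaSmoothInLast264 γ S.β → BetaDerivsUniformInLast264 γ S.β bt →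
        (∀ (k : ℕ) (p : Fin (k + 1) → ℝ), p ∈ B12Beta.HistBox γ k → 2 * b ≤ S.β k (Function.update p (Fin.last k) 0)) →
        bt 1 * γ ≤ b → Theorem2Statement S (hL_of_standing hH)) := by
  obtain ⟨S, hβ, hcpl, hγ, -, hH, hD, hC⟩ := histJumpToy_exists
  have hnot : ¬ Theorem2Statement S (hL_of_standing hH) :=
    not_theorem2Statement_of_gap hcpl (readout_gap_unbounded (by norm_num) (by norm_num))
  refine ⟨fun h => hnot (h S hH hD hC (1 / 100) (by norm_num) (betaPertH_of_histJump hβ jump_nonneg jump_le_sq)),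
    fun h => hnot (h S hH hD hC 1 (1 / 100) (1 / 100 + 1 ^ 3) one_pos (by norm_num) (by norm_num)
      (betaLowerH_of_histJump hβ jump_nonneg jump_le_sq 1) (betaUpperH_of_histJump hβ jump_nonneg jump_le_sq one_pos)),
    fun h => hnot (h S hH hD hC (1 / 10) (1 / 200) _ (by norm_num) (by norm_num) (betaSmoothInLast264_of_histJump hβ (1 / 10))
      (betaDerivsUniformInLast264_of_histJump hβ (by norm_num) jump_nonneg jump_le_sq (by norm_num))
      (fun k p hp => by rw [face_eq hβ]; norm_num) (by norm_num))⟩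

/-- **For the toy, ¬(C) also FOLLOWS from prover 1's reduction**: `theorem2Statement_of_pertH` turns `BetaPertH` + (C) into Theorem 2, and
Theorem 2 fails — so the reduction itself certifies that β₂ is not jointly continuous on any box (consistent with §5's direct proof).
[cite: Balaban1987RG1, Thm 2 p.259] -/
theorem not_betaContH_via_reduction {S : Setting} (hH : StandingHypotheses S) (hD : Definitions S) {βbar : ℝ} (hbar : 0 < βbar)
    (hpert : BetaPertH S.β βbar) (hnot : ¬ Theorem2Statement S (hL_of_standing hH)) {γ : ℝ} (hγ : 0 < γ) : ¬ BetaContH γ S.β :=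
  fun hcont => hnot (theorem2Statement_of_pertH hH hD hbar hpert hγ hcont)

/-- **THE CONTRAST — p. 266's PLURAL SUPPLIES (C).**  Under the reading `BetaAnalyticInCouplings266 γ S.β` of p. 266's *"the functions
E^{(j)}, β_j are analytic functions of the effective coupling constants"* (JOINT analyticity on [0, γ]^{k+1}; typed in
`B12CouplingClausesHistory`, NOT a conjunct of `Conclusions.c264`), the printed `Definitions` and the wall `BetaPertH S.β β̄` (β̄ > 0) give
[I] Theorem 2 AS PRINTED: `betaContH_of_analyticInCouplings266` feeds prover 1's `theorem2Statement_of_pertH`.  A REDUCTION; `BetaPertH` and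
the plural reading for Bałaban's β are NOT discharged. [cite: Balaban1987RG1, p.266 (paragraph after (2.9)) with Thm 2 p.259] -/
theorem theorem2Statement_of_pertH_of_couplings266 {S : Setting} (hH : StandingHypotheses S) (hD : Definitions S) {βbar γ : ℝ}
    (hbar : 0 < βbar) (hpert : BetaPertH S.β βbar) (hγ : 0 < γ) (hA : BetaAnalyticInCouplings266 γ S.β) :
    Theorem2Statement S (hL_of_standing hH) :=
  theorem2Statement_of_pertH hH hD hbar hpert hγ (betaContH_of_analyticInCouplings266 hA)

/-- … and the toy violates the plural reading on every cube (it would give (C)). [cite: Balaban1987RG1, p.266 (paragraph after (2.9))] -/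
theorem not_analyticInCouplings266_of_toy
    (hβ : ∀ (k : ℕ) (p : Fin (k + 1) → ℝ), S.β k p = 1 / 100 +
      (if k = 1 then Set.indicator (Set.range fun n : ℕ => 1 / ((n : ℝ) + 2)) (fun x : ℝ => x ^ 2) (p 0) else 0) * p (Fin.last k))
    {γ : ℝ} (hγ : 0 < γ) : ¬ BetaAnalyticInCouplings266 γ S.β :=
  fun hA => not_betaContH_of_histJumpD hβ hγ (betaContH_of_analyticInCouplings266 hA)

end

end Summit.QuantumFields.BalabanUV.Beta.EriceFlowEnclosureB12AsPrintedHistoryJumpEnd
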